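import Mathlib
import Summits.QuantumFields.QCD.Theses.PauliWegnerSea
import Summits.QuantumFields.QCD.Theses.WilsonMobilityGap
import Summits.QuantumFields.QCD.Theorems.PauliWegnerSeaPhaseQuenchedFlavourDecayReduction
import Summits.QuantumFields.QCD.Theorems.PauliWegnerSeaPhaseQuenchedFlavourDecayMinorMomentsCoreOfUniform
import Summits.QuantumFields.QCD.Theorems.PauliWegnerSeaPhaseQuenchedFlavourDecayConstRegularisation

/-!
# The reg-free UNIFORM reduction of crux `PhaseQuenchedFlavourDecay` and its fixed-point content
(line `crossing-split-integrability`, lead c6, 2026-08-16; crux stmt-QuantumFields-9151,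
`Summit.QuantumFields.QCD.Theses.PauliWegnerSea.PhaseQuenchedFlavourDecay` =
`Summit.QuantumFields.QCD.Theses.WilsonMobilityGap.PhaseQuenchedFlavourDecay`)

`QCDRegularisation N_f` constrains only `a_k > 0`, `a_k → 0`, `a_k L_k → ∞`, `Z_m > 0`: the couplings `β_k`, the critical
masses `m_crit(k)` and the scale `a_k / Z_m(k)` are free.  Two consequences, composed here from landed `--supports` files:

* `phaseQuenchedFlavourDecay_of_uniformMinorMoments` — the crux (both route copies) follows from the reg-free UNIFORM form of
  the open core ("Fredenhagen–Marcu data `(s, C, μ)` of the phase-quenched propagator at a lattice parameter point `(β, mq)`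
  control the `(1+ε)`-moments of all Wick minors, constants depending on `(s, C)` only"): `stub_minorMomentsCore_of_uniform`
  (p122368) then `phaseQuenchedFlavourDecay_of_aprioriMinorMoments` (p105597).  By `stub_uniformPencil_of_minorMomentsCore`
  (p122665) the registered core conversely forces pencil-uniform constants, so nothing is lost by promoting the uniform form.
* `clusterAt_of_phaseQuenchedFlavourDecay` — the crux CONTAINS the fixed-point statement: at every lattice parameter point
  `(β, c, λ > 0)` (bare masses `c + λ m`), exponential phase-quenched fractional-moment decay of the propagator at some lattice
  rate, uniformly in large volumes, implies exponential clustering of every flavour-charged pair `(A, B)` at its own rate and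
  amplitude, uniformly in large volumes (constant-regularisation dictionary `stub_existsConstRegularisation`,
  `stub_upperConstIff`, `stub_concConstIff`, p122663).  A single parameter point violating it refutes the crux.
  `clusterAt_of_aprioriMinorMoments`: the same modulo the one open stub.

All statements are registered sub-goals of the crux item (expanded, tree vocabulary; no new definitions).
-/

noncomputable section

namespace Summit.QuantumFields.QCD.Cruxes.PhaseQuenchedFlavourDecay.CrossingSplitIntegrability

open scoped BigOperators
open MeasureTheory Filter
open Literature.MathematicalPhysics.QuantumFieldTheory Literature.MathematicalPhysics.QuantumLattice
  Literature.Probability.LatticeModels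

/-- **The crux from the reg-free uniform core.**  If, for every `N_f` and Fredenhagen–Marcu data `(s, C)`, there are
`ε > 0` and for every rank `r` constants `C_r, μ₀ > 0, Λ₀` such that at every lattice parameter point `(β, mq)`, every rate
`0 < μ ≤ μ₀` and every `L` with `Λ₀ ≤ μ L`, FM decay `≤ C e^{-μ‖v‖}` on the volumes `S ≥ L` bounds the phase-quenched
`(1+ε)`-moments of all `r × r` Wick minors by `C_r` on those volumes — then `PauliWegnerSea.PhaseQuenchedFlavourDecay`. -/
theorem phaseQuenchedFlavourDecay_of_uniformMinorMoments :
    (∀ (Nf : ℕ) (s C : ℝ), 0 < s → s < 1 → ∃ ε : ℝ, 0 < ε ∧ ∀ r : ℕ, ∃ Cr μ₀ Λ₀ : ℝ, 0 < μ₀ ∧ ∀ (β : ℝ) (mq : Fin Nf → ℝ) (μ : ℝ) (L : ℕ), 0 < μ → μ ≤ μ₀ → Λ₀ ≤ μ * L → (∀ S : ℕ, L ≤ S → ∀ (f : Fin Nf) (v : Literature.Probability.LatticeModels.Site 4), v ∈ box 4 S → (∫ U : GaugeConfig 4 (2 * S + 1) (Matrix.specialUnitaryGroup (Fin 3) ℂ),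 ‖(diracMatrix U mq).det‖ * (∑ a : Fin 3, ∑ i : Fin 4, ∑ b : Fin 3, ∑ j : Fin 4, ‖(diracMatrix U mq)⁻¹ (quarkEquiv (f, (Torus.proj (2 * S + 1) 0, a, i))) (quarkEquiv (f, (Torus.proj (2 * S + 1) (v), b, j)))‖) ^ s ∂(wilsonMeasure (fundamentalRep (Fin 3)) β)) / (∫ U : GaugeConfig 4 (2 * S + 1) (Matrix.specialUnitaryGroup (Fin 3) ℂ), ‖(diracMatrix U mq).det‖ ∂(wilsonMeasure (fundamentalRep (Fin 3)) β)) ≤ C * Real.exp (-(μ * ‖v‖))) → ∀ S : ℕ, L ≤ S → ∀ I J : Fin r → QuarkVar Nf (2 * S + 1), Integrable (fun U : GaugeConfig 4 (2 * S + 1) SU3 => ‖(Matrix.of fun a b : Fin r => (diracMatrix U mq)⁻¹ (quarkEquiv (I a)) (quarkEquiv (J b))).det‖ ^ (1 + ε)) (qcdLatticeMeasure (2 * S + 1) β mq) ∧ qcdPhaseQuenchedExpect β (2 * S + 1) mq (fun U : GaugeConfig 4 (2 * S + 1) SU3 => ‖(Matrix.of fun a b : Fin r => (diracMatrix U mq)⁻¹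 (quarkEquiv (I a)) (quarkEquiv (J b))).det‖ ^ (1 + ε)) ≤ Cr) → Summit.QuantumFields.QCD.Theses.PauliWegnerSea.PhaseQuenchedFlavourDecay :=
  fun h => phaseQuenchedFlavourDecay_of_aprioriMinorMoments (stub_minorMomentsCore_of_uniform h)

/-- The sibling route's copy of the crux from the reg-free uniform core. -/
theorem wmgPhaseQuenchedFlavourDecay_of_uniformMinorMoments :
    (∀ (Nf : ℕ) (s C : ℝ), 0 < s → s < 1 → ∃ ε : ℝ, 0 < ε ∧ ∀ r : ℕ, ∃ Cr μ₀ Λ₀ : ℝ, 0 < μ₀ ∧ ∀ (β : ℝ) (mq : Fin Nf → ℝ) (μ : ℝ) (L : ℕ), 0 < μ → μ ≤ μ₀ → Λ₀ ≤ μ * L → (∀ S : ℕ, L ≤ S → ∀ (f : Fin Nf) (v : Literature.Probability.LatticeModels.Site 4), v ∈ box 4 S → (∫ U : GaugeConfig 4 (2 * S + 1) (Matrix.specialUnitaryGroup (Fin 3) ℂ), ‖(diracMatrix U mq).det‖ * (∑ a : Fin 3, ∑ i : Fin 4, ∑ b : Fin 3, ∑ j : Fin 4, ‖(diracMatrix U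 mq)⁻¹ (quarkEquiv (f, (Torus.proj (2 * S + 1) 0, a, i))) (quarkEquiv (f, (Torus.proj (2 * S + 1) (v), b, j)))‖) ^ s ∂(wilsonMeasure (fundamentalRep (Fin 3)) β)) / (∫ U : GaugeConfig 4 (2 * S + 1) (Matrix.specialUnitaryGroup (Fin 3) ℂ), ‖(diracMatrix U mq).det‖ ∂(wilsonMeasure (fundamentalRep (Fin 3)) β)) ≤ C * Real.exp (-(μ * ‖v‖))) → ∀ S : ℕ, L ≤ S → ∀ I J : Fin r → QuarkVar Nf (2 * S + 1), Integrable (fun U : GaugeConfig 4 (2 * S + 1) SU3 => ‖(Matrix.of fun a b : Fin r => (diracMatrix U mq)⁻¹ (quarkEquiv (I a)) (quarkEquiv (J b))).det‖ ^ (1 + ε)) (qcdLatticeMeasure (2 * S + 1) β mq) ∧ qcdPhaseQuenchedExpect β (2 * S + 1) mq (fun U : GaugeConfig 4 (2 * S + 1) SU3 => ‖(Matrix.of fun a b : Fin r => (diracMatrix U mq)⁻¹ (quarkEquiv (I a)) (quarkEquiv (J b))).det‖ ^ (1 + ε)) ≤ Cr) → Summit.QuantumFields.QCD.Theses.WilsonMobilityGap.PhaseQuenchedFlavourDecay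 :=
  fun h => wmgPhaseQuenchedFlavourDecay_of_aprioriMinorMoments (stub_minorMomentsCore_of_uniform h)

/-- **The crux contains the fixed-point clustering statement.**  `PhaseQuenchedFlavourDecay` implies: for every `N_f`,
every `m > 0` and EVERY lattice parameter point `(β, c, λ > 0)`, exponential phase-quenched fractional-moment decay of the
propagator at the point (some exponent `s ∈ (0,1)`, amplitude `C`, lattice rate `μ > 0`, all volumes `S ≥ S₀`) implies that
every flavour-charged pair `(A, B)` clusters exponentially (`‖⟨A(0)B(n e₀)⟩‖ ≤ C' e^{-μ' n}`, own `C', μ' > 0`, all volumes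
`S ≥ S₀'`, `n ≤ S`).  Proof: run the crux along the constant regularisation through the point. -/
theorem clusterAt_of_phaseQuenchedFlavourDecay :
    Summit.QuantumFields.QCD.Theses.PauliWegnerSea.PhaseQuenchedFlavourDecay → ∀ (Nf : ℕ) (m : Fin Nf → ℝ), (∀ f, 0 < m f) → ∀ (β c lam : ℝ), 0 < lam → (∃ s C μ : ℝ, 0 < s ∧ s < 1 ∧ 0 < μ ∧ ∃ S₀ : ℕ, ∀ S : ℕ, S₀ ≤ S → ∀ (f : Fin Nf) (v : Literature.Probability.LatticeModels.Site 4), v ∈ box 4 S → (∫ U : GaugeConfig 4 (2 * S + 1) (Matrix.specialUnitaryGroup (Fin 3) ℂ), ‖(diracMatrix U fun fl => c + lam * m fl).det‖ * (∑ a : Fin 3, ∑ i : Fin 4, ∑ b : Fin 3, ∑ j : Fin 4, ‖(diracMatrix U fun fl => c + lam * m fl)⁻¹ (quarkEquiv (f, (Torus.proj (2 * S + 1) 0, a, i))) (quarkEquiv (f, (Torus.proj (2 * S + 1) (v), b, j)))‖) ^ s ∂(wilsonMeasure (fundamentalRep (Fin 3)) β)) / (∫ U : GaugeConfig 4 (2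 * S + 1) (Matrix.specialUnitaryGroup (Fin 3) ℂ), ‖(diracMatrix U fun fl => c + lam * m fl).det‖ ∂(wilsonMeasure (fundamentalRep (Fin 3)) β)) ≤ C * Real.exp (-(μ * ‖v‖))) → ∀ (R R' : ℕ) (A : QCDLatticeObservable Nf R) (B : QCDLatticeObservable Nf R'), (∃ (f₀ : Fin Nf) (q : ℤ), q ≠ 0 ∧ ∀ (θ : ℝ) (U : LGConfig 4 (Matrix.specialUnitaryGroup (Fin 3) ℂ)), ExteriorAlgebra.map (LinearMap.pi fun w => (Sum.elim (fun i => if (boxQuarkEquiv.symm i).1 = f₀ then Complex.exp (-((θ : ℂ) * Complex.I)) else 1) (fun i => if (boxQuarkEquiv.symm i).1 = f₀ then Complex.exp ((θ : ℂ) * Complex.I) else 1) (ofLex w)) • LinearMap.proj w) (A.F U) = Complex.exp (((q : ℝ) * θ : ℝ) * Complex.I) • A.F U) → ∃ C' μ' : ℝ, 0 < μ' ∧ ∃ S₀ : ℕ, ∀ S : ℕ, S₀ ≤ S → ∀ n : ℕ, n ≤ S → ‖(∫ U : GaugeConfig 4 (2 * S + 1) (Matrix.specialUnitaryGroup (Fin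 3) ℂ), (‖(diracMatrix U fun fl => c + lam * m fl).det‖ : ℂ) * (fermiIntegral (A.onTorus (2 * S + 1) 0 U * B.onTorus (2 * S + 1) (Pi.single 0 (n : ℤ)) U * fermiBoltzmann U fun fl => c + lam * m fl) / fermiIntegral (fermiBoltzmann U fun fl => c + lam * m fl)) ∂(wilsonMeasure (fundamentalRep (Fin 3)) β)) / (∫ U : GaugeConfig 4 (2 * S + 1) (Matrix.specialUnitaryGroup (Fin 3) ℂ), (‖(diracMatrix U fun fl => c + lam * m fl).det‖ : ℂ) ∂(wilsonMeasure (fundamentalRep (Fin 3)) β))‖ ≤ C' * Real.exp (-(μ' * n)) := by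
  intro h Nf m hm β c lam hlam hF
  obtain ⟨reg, h1, h2, h3⟩ := stub_existsConstRegularisation Nf β c lam hlam
  unfold Summit.QuantumFields.QCD.Theses.PauliWegnerSea.PhaseQuenchedFlavourDecay at h
  exact (stub_concConstIff Nf reg m β c lam h1 h2 h3).1 (h Nf reg m hm ((stub_upperConstIff Nf reg m β c lam h1 h2 h3).2 hF))

/-- **Fixed-point clustering modulo the one open stub** (`stub_minorMomentsCore`, hypothesis verbatim). -/
theorem clusterAt_of_aprioriMinorMoments :
    (∀ (Nf : ℕ) (reg : QCDRegularisation Nf) (m : Fin Nf → ℝ), (∀ f, 0 < m f) → (∃ s δ C : ℝ, 0 < s ∧ s < 1 ∧ 0 < δ ∧ ∀ᶠ k in atTop, ∀ S : ℕ, reg.L k ≤ S → ∀ (f : Fin Nf) (v : Literature.Probability.LatticeModels.Site 4), v ∈ box 4 S → (∫ U : GaugeConfig 4 (2 * S + 1) (Matrix.specialUnitaryGroup (Fin 3) ℂ), ‖(diracMatrix U fun fl => reg.mcrit k + reg.a k * m fl / reg.Zm k).det‖ * (∑ a : Fin 3, ∑ i : Fin 4, ∑ b : Fin 3, ∑ j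 : Fin 4, ‖(diracMatrix U fun fl => reg.mcrit k + reg.a k * m fl / reg.Zm k)⁻¹ (quarkEquiv (f, (Torus.proj (2 * S + 1) 0, a, i))) (quarkEquiv (f, (Torus.proj (2 * S + 1) (v), b, j)))‖) ^ s ∂(wilsonMeasure (fundamentalRep (Fin 3)) (reg.β k))) / (∫ U : GaugeConfig 4 (2 * S + 1) (Matrix.specialUnitaryGroup (Fin 3) ℂ), ‖(diracMatrix U fun fl => reg.mcrit k + reg.a k * m fl / reg.Zm k).det‖ ∂(wilsonMeasure (fundamentalRep (Fin 3)) (reg.β k))) ≤ C * Real.exp (-(δ * (reg.a k * ‖v‖)))) → ∃ ε : ℝ, 0 < ε ∧ ∀ r : ℕ, ∃ C : ℝ, ∀ᶠ k in atTop, ∀ S : ℕ, reg.L k ≤ S → ∀ I J : Fin r → QuarkVar Nf (2 * S + 1), Integrable (fun U : GaugeConfig 4 (2 * S + 1) SU3 => ‖(Matrix.of fun a b : Fin r => (diracMatrix U fun fl => reg.mcrit k + reg.a k * m fl / reg.Zm k)⁻¹ (quarkEquiv (I a)) (quarkEquiv (J b))).det‖ ^ (1 + ε)) (qcdLatticeMeasure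 (2 * S + 1) (reg.β k) fun fl => reg.mcrit k + reg.a k * m fl / reg.Zm k) ∧ qcdPhaseQuenchedExpect (reg.β k) (2 * S + 1) (fun fl => reg.mcrit k + reg.a k * m fl / reg.Zm k) (fun U : GaugeConfig 4 (2 * S + 1) SU3 => ‖(Matrix.of fun a b : Fin r => (diracMatrix U fun fl => reg.mcrit k + reg.a k * m fl / reg.Zm k)⁻¹ (quarkEquiv (I a)) (quarkEquiv (J b))).det‖ ^ (1 + ε)) ≤ C) → ∀ (Nf : ℕ) (m : Fin Nf → ℝ), (∀ f, 0 < m f) → ∀ (β c lam : ℝ), 0 < lam → (∃ s C μ : ℝ, 0 < s ∧ s < 1 ∧ 0 < μ ∧ ∃ S₀ : ℕ, ∀ S : ℕ, S₀ ≤ S → ∀ (f : Fin Nf) (v : Literature.Probability.LatticeModels.Site 4), v ∈ box 4 S → (∫ U : GaugeConfig 4 (2 * S + 1) (Matrix.specialUnitaryGroup (Fin 3) ℂ), ‖(diracMatrix U fun fl => c + lam * m fl).det‖ * (∑ a : Fin 3, ∑ i : Fin 4, ∑ b : Fin 3, ∑ j : Fin 4, ‖(diracMatrix U fun fl => c + lam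 * m fl)⁻¹ (quarkEquiv (f, (Torus.proj (2 * S + 1) 0, a, i))) (quarkEquiv (f, (Torus.proj (2 * S + 1) (v), b, j)))‖) ^ s ∂(wilsonMeasure (fundamentalRep (Fin 3)) β)) / (∫ U : GaugeConfig 4 (2 * S + 1) (Matrix.specialUnitaryGroup (Fin 3) ℂ), ‖(diracMatrix U fun fl => c + lam * m fl).det‖ ∂(wilsonMeasure (fundamentalRep (Fin 3)) β)) ≤ C * Real.exp (-(μ * ‖v‖))) → ∀ (R R' : ℕ) (A : QCDLatticeObservable Nf R) (B : QCDLatticeObservable Nf R'), (∃ (f₀ : Fin Nf) (q : ℤ), q ≠ 0 ∧ ∀ (θ : ℝ) (U : LGConfig 4 (Matrix.specialUnitaryGroup (Fin 3) ℂ)), ExteriorAlgebra.map (LinearMap.pi fun w => (Sum.elim (fun i => if (boxQuarkEquiv.symm i).1 = f₀ then Complex.exp (-((θ : ℂ) * Complex.I)) else 1) (fun i => if (boxQuarkEquiv.symm i).1 = f₀ then Complex.exp ((θ : ℂ) * Complex.I) else 1) (ofLex w)) • LinearMap.proj w) (A.F U) = Complex.exp (((q : ℝ) * θ : ℝ) *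 Complex.I) • A.F U) → ∃ C' μ' : ℝ, 0 < μ' ∧ ∃ S₀ : ℕ, ∀ S : ℕ, S₀ ≤ S → ∀ n : ℕ, n ≤ S → ‖(∫ U : GaugeConfig 4 (2 * S + 1) (Matrix.specialUnitaryGroup (Fin 3) ℂ), (‖(diracMatrix U fun fl => c + lam * m fl).det‖ : ℂ) * (fermiIntegral (A.onTorus (2 * S + 1) 0 U * B.onTorus (2 * S + 1) (Pi.single 0 (n : ℤ)) U * fermiBoltzmann U fun fl => c + lam * m fl) / fermiIntegral (fermiBoltzmann U fun fl => c + lam * m fl)) ∂(wilsonMeasure (fundamentalRep (Fin 3)) β)) / (∫ U : GaugeConfig 4 (2 * S + 1) (Matrix.specialUnitaryGroup (Fin 3) ℂ), (‖(diracMatrix U fun fl => c + lam * m fl).det‖ : ℂ) ∂(wilsonMeasure (fundamentalRep (Fin 3)) β))‖ ≤ C' * Real.exp (-(μ' * n)) :=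
  fun hB => clusterAt_of_phaseQuenchedFlavourDecay (phaseQuenchedFlavourDecay_of_aprioriMinorMoments hB)

end Summit.QuantumFields.QCD.Cruxes.PhaseQuenchedFlavourDecay.CrossingSplitIntegrability

end
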